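import Summits.KontsevichZagierPeriods.KontsevichZagierPeriods.Theorems.IsogenyCertificatesXMapKernelStubHuberWustholzSplitting
import Summits.KontsevichZagierPeriods.KontsevichZagierPeriods.Theorems.IsogenyCertificatesAlgebraicModuliRealPeriodCellPeriodRep
import Literature.NumberTheory.Transcendental.ManyCurveThetaClassification
import Literature.NumberTheory.EllipticCurves.RealPeriodProofs

/-!
# `AlgebraicModuliRealPeriodCell` (stmt-KontsevichZagierPeriods-18265, route IsogenyCertificates) —
line `Sketch`, stub **Ia**: class reduction with real-algebraic coefficients

Support file for the crux `IsogenyCertificates.AlgebraicModuliRealPeriodCell`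
(stmt-KontsevichZagierPeriods-18265), line `Sketch`, stub `stub_algClassReduction` (Ia). It is the
port of the parent crux's `XMapKernelStubClassReduction.stub_classReduction` (moduli `A, B ∈ ℤ`,
scalars `q ∈ ℚ`, Huber–Wüstholz as a hypothesis) one field up: moduli `α, β` and scalars `q` in
`ℚ̄ ∩ ℝ`, and the Huber–Wüstholz fact is now the tree THEOREM
`Literature.NumberTheory.Transcendental.HuberWustholzManyCurvePeriods_holds`.

**Statement (Ia).** A vanishing real-algebraic combination `∑ᵢ qᵢ Ωᵢ = 0` of the full real periods
`Ωᵢ = ∫_{Pᵢ > 0} dx/√Pᵢ` of the nonsingular real-algebraic cubics `Pᵢ = x³ + αᵢx + βᵢ` vanishes on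
every LATTICE-ISOGENY CLASS: for each `i` there is a lattice `L₀` with invariants
`(g₂, g₃) = (−4αᵢ, −4βᵢ)` (the lattice of `y² = Pᵢ` with `℘ = x`, `℘' = 2y`) such that for every
`S` which is exactly the set of indices `j` whose lattice (the lattice with invariants
`(−4αⱼ, −4βⱼ)`) receives a non-zero multiple of `Λ₀`, the partial sum `∑_{j ∈ S} qⱼ Ωⱼ` vanishes.

**Proof.** For each `j` the line's foundation `AlgRealPeriodCell.PeriodRep.exists_periodPair`
(Silverman AEC VI.5.1 + C.16 for the short model `⟨0, 0, 0, αⱼ, βⱼ⟩`) gives a real period pair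
`Lⱼ` with `g₂ = −4αⱼ`, `g₃ = −4βⱼ` and `Ωⱼ = nⱼ · Ω₀ⱼ`, `nⱼ ∈ {1, 2}` the number of real
components and `Ω₀ⱼ = min {t > 0 | t ∈ Λⱼ} ∈ Λⱼ` (`IsReal.minRealPeriod_mem_lattice`), so
`Ω₀ⱼ = aⱼ ω₁⁽ʲ⁾ + bⱼ ω₂⁽ʲ⁾` with `aⱼ, bⱼ ∈ ℤ`. The relation reads, in `ℂ`,
`∑ⱼ (cⱼ ω₁⁽ʲ⁾ + c'ⱼ ω₂⁽ʲ⁾) = 0` with the ALGEBRAIC coefficients `cⱼ = qⱼ nⱼ aⱼ`, `c'ⱼ = qⱼ nⱼ bⱼ`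
(`qⱼ ∈ ℚ̄ ∩ ℝ ⊆ ℚ̄`), and the invariants `−4αⱼ, −4βⱼ` are algebraic. The landed splitting stub T
(`HuberWustholzSplitting.stub_huberWustholzSplitting_of`: the relation splits along the classes of
`PeriodPair.IsIsogenousTo`), fed with the tree theorem `HuberWustholzManyCurvePeriods_holds`,
applies; its class predicate `Λᵢ ~ Λⱼ` is equivalent to Ia's
(`∃ L' μ, g₂(L') = −4αⱼ ∧ g₃(L') = −4βⱼ ∧ μ ≠ 0 ∧ μΛᵢ ⊆ Λ_{L'}`) with `L₀ := Lᵢ`, because a lattice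
with the invariants of `Lⱼ` IS `Λⱼ` (`PeriodPair.uniformization_unique_holds`). Casting T's
conclusion back to `ℝ` gives the claim. No definitions, no new named facts.

References: Silverman, *The Arithmetic of Elliptic Curves* (2009), Thm. VI.5.1, C.16;
Huber–Wüstholz, *Transcendence and linear relations of 1-periods* (2022), Thm. 15.3;
Baker–Wüstholz, *Logarithmic Forms and Diophantine Geometry* (2007), §6.2 Thm. 6.4.
-/

noncomputable section

namespace Summit.KontsevichZagierPeriods.IsogenyCertificates.AlgRealPeriodCell.ClassReduction

open scoped BigOperators
open Literature.NumberTheory.Transcendental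
open Summit.KontsevichZagierPeriods.IsogenyCertificates.XMapKernelStubs (HuberWustholzSplitting.stub_huberWustholzSplitting_of)
open Summit.KontsevichZagierPeriods.IsogenyCertificates.AlgRealPeriodCell.PeriodRep (exists_periodPair)

/-- **Ia — class reduction** with real-algebraic moduli and scalars: a vanishing
`(ℚ̄ ∩ ℝ)`-combination `∑ᵢ qᵢ Ωᵢ = 0` of full real periods `Ωᵢ = ∫_{Pᵢ > 0} dx/√Pᵢ`,
`Pᵢ = x³ + αᵢx + βᵢ` nonsingular with `αᵢ, βᵢ ∈ ℚ̄ ∩ ℝ`, vanishes on each lattice-isogeny class: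
for each `i` there is a lattice `L₀` with invariants `(−4αᵢ, −4βᵢ)` such that for every `S` that is
exactly `{j | the lattice with invariants (−4αⱼ, −4βⱼ) receives a non-zero multiple of Λ₀}` the
partial sum over `S` vanishes. Proof in the module docstring: real period lattices `Lⱼ`
(`PeriodRep.exists_periodPair`), integer coordinates of `Ω₀ⱼ ∈ Λⱼ`, the splitting stub T
(`stub_huberWustholzSplitting_of`) over the tree theorem `HuberWustholzManyCurvePeriods_holds` with
algebraic coefficients, and the identification of the two class predicates by
`PeriodPair.uniformization_unique_holds`; `L₀ := Lᵢ`.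
[cite: HuberWustholz2022, Thm. 15.3 (1),(3) with §15.2.2; BakerWustholz2007 §6.2 Thm. 6.4] -/
theorem stub_algClassReduction : ∀ (k : ℕ) (α β q : Fin k → ℝ), (∀ i, IsAlgebraic ℚ (α i) ∧ IsAlgebraic ℚ (β i) ∧ IsAlgebraic ℚ (q i)) → (∀ i, 4 * α i ^ 3 + 27 * β i ^ 2 ≠ 0) → ∑ i, q i * (∫ x in {x : Fin 1 → ℝ | 0 < x 0 ^ 3 + α i * x 0 + β i}, 1 / Real.sqrt (x 0 ^ 3 + α i * x 0 + β i)) = 0 → ∀ i, ∃ L₀ : PeriodPair, L₀.g₂ = -4 * ((α i : ℝ) : ℂ) ∧ L₀.g₃ = -4 * ((β i : ℝ) : ℂ) ∧ ∀ S : Finset (Fin k), (∀ j, j ∈ S ↔ ∃ (L' : PeriodPair) (μ : ℂ), L'.g₂ = -4 * ((α j : ℝ) : ℂ) ∧ L'.g₃ = -4 * ((β j : ℝ) : ℂ) ∧ μ ≠ 0 ∧ ∀ l ∈ L₀.lattice, μ * l ∈ L'.lattice) → ∑ j ∈ S, q j * (∫ x in {x : Fin 1 → ℝ | 0 < x 0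 ^ 3 + α j * x 0 + β j}, 1 / Real.sqrt (x 0 ^ 3 + α j * x 0 + β j)) = 0 := by
  intro k α β q halg hns hsum i
  -- the real period lattices `Lⱼ`, the integer coordinates of `Ω₀ⱼ ∈ Λⱼ`, `nⱼ ∈ {1, 2}`
  choose L hg₂ hg₃ hreal hΩ using fun j => exists_periodPair (hns j)
  choose a b hab using fun j => PeriodPair.mem_lattice.1 (hreal j).minRealPeriod_mem_lattice
  obtain ⟨n, hn⟩ : ∃ n : Fin k → ℕ, ∀ j,
      (⟨0, 0, 0, α j, β j⟩ : WeierstrassCurve ℝ).numRealComponents = n j :=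
    ⟨_, fun j => rfl⟩
  refine ⟨L i, hg₂ i, hg₃ i, fun S hS => ?_⟩
  simp only [hΩ, hn] at hsum ⊢
  -- real algebraic numbers are algebraic complex numbers
  have hℂ : ∀ t : ℝ, IsAlgebraic ℚ t → IsAlgebraic ℚ (t : ℂ) := fun t ht =>
    (isAlgebraic_algebraMap_iff (algebraMap ℝ ℂ).injective).2 ht
  have h4 : IsAlgebraic ℚ (-4 : ℂ) := by
    have h := isAlgebraic_int (R := ℚ) (A := ℂ) (-4)
    push_cast at h
    exact h
  -- the data fed to T: algebraic invariants and algebraic coefficients on `ω₁⁽ʲ⁾, ω₂⁽ʲ⁾`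
  have hLalg : ∀ j, IsAlgebraic ℚ (L j).g₂ ∧ IsAlgebraic ℚ (L j).g₃ := fun j =>
    ⟨(hg₂ j).symm ▸ h4.mul (hℂ _ (halg j).1), (hg₃ j).symm ▸ h4.mul (hℂ _ (halg j).2.1)⟩
  have hβalg : ∀ j, IsAlgebraic ℚ ((q j : ℂ) * (n j : ℂ) * (a j : ℂ)) ∧
      IsAlgebraic ℚ ((q j : ℂ) * (n j : ℂ) * (b j : ℂ)) := fun j =>
    ⟨((hℂ _ (halg j).2.2).mul (isAlgebraic_nat _)).mul (isAlgebraic_int _),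
      ((hℂ _ (halg j).2.2).mul (isAlgebraic_nat _)).mul (isAlgebraic_int _)⟩
  have hterm : ∀ j, (q j : ℂ) * (n j : ℂ) * (a j : ℂ) * (L j).ω₁ +
      (q j : ℂ) * (n j : ℂ) * (b j : ℂ) * (L j).ω₂
      = (((q j : ℝ) * ((n j : ℝ) * (L j).minRealPeriod) : ℝ) : ℂ) := by
    intro j
    push_cast
    rw [← hab j]
    ring
  have hsum' : ∑ j, ((q j : ℂ) * (n j : ℂ) * (a j : ℂ) * (L j).ω₁ +
      (q j : ℂ) * (n j : ℂ) * (b j : ℂ) * (L j).ω₂) = 0 := by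
    rw [Finset.sum_congr rfl fun j _ => hterm j, ← Complex.ofReal_sum, hsum, Complex.ofReal_zero]
  -- the two class predicates agree (uniqueness of the lattice with given invariants)
  have hS' : ∀ j, j ∈ S ↔ (L i).IsIsogenousTo (L j) := by
    intro j
    rw [hS j]
    constructor
    · rintro ⟨L', μ, h₂', h₃', hμ, hμL⟩
      have hlat : L'.lattice = (L j).lattice :=
        PeriodPair.uniformization_unique_holds L' (L j) (h₂'.trans (hg₂ j).symm)
          (h₃'.trans (hg₃ j).symm)
      exact ⟨μ, hμ, fun l hl => hlat ▸ hμL l hl⟩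
    · rintro ⟨μ, hμ, hμL⟩
      exact ⟨L j, μ, hg₂ j, hg₃ j, hμ, hμL⟩
  -- T over the tree theorem `HuberWustholzManyCurvePeriods_holds`, and back to `ℝ`
  have key : ∑ j ∈ S, ((q j : ℂ) * (n j : ℂ) * (a j : ℂ) * (L j).ω₁ +
      (q j : ℂ) * (n j : ℂ) * (b j : ℂ) * (L j).ω₂) = 0 :=
    HuberWustholzSplitting.stub_huberWustholzSplitting_of HuberWustholzManyCurvePeriods_holds k L
      (fun j => (q j : ℂ) * (n j : ℂ) * (a j : ℂ)) (fun j => (q j : ℂ) * (n j : ℂ) * (b j : ℂ))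
      hLalg hβalg hsum' i S hS'
  rw [Finset.sum_congr rfl fun j _ => hterm j, ← Complex.ofReal_sum] at key
  exact Complex.ofReal_eq_zero.1 key

end Summit.KontsevichZagierPeriods.IsogenyCertificates.AlgRealPeriodCell.ClassReduction

end
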